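import Summits.NavierStokesRegularity.FunctionalMining.TopEigGapCoerciveHigh
import Summits.NavierStokesRegularity.FunctionalMining.BiaxialEikonalSpectrumDir
import Summits.NavierStokesRegularity.FunctionalMining.TopEigHeatCoerciveSymm
import Summits.NavierStokesRegularity.FunctionalMining.TopEigLaminateClass
import Summits.NavierStokesRegularity.FunctionalMining.TopEigSimpleGap
import Summits.NavierStokesRegularity.FunctionalMining.NoGo.TopEigHeatCoerciveOne
import HarnessLib

/-!
# NO-GO K36 — the SINGULAR-STRAIN class `det S ≡ 0` (= `λ₂ ≡ 0`: all laminates, all unidirectional shear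
# fields, all horizontal planar flows) refutes L-λ(q) for NO real `q ≥ 2`, and does refute it at `q = 1`

search for candidate a priori estimates; no regularity claim.

Cell `pub-nsfunc` (NS FUNCTIONAL MINING), NOGO seat: the WITNESS SET of the wanted kill (F2) =
`¬ TopEig.TopEigHeatCoercivePos q` (Lemma L-λ(q): `∃ c > 0, c·∫(λ₁⁺)^q ≤ heatDissipation (∫(λ₁⁺)^q)` on
smooth divergence-free zero-mean fields of `T³`; OPEN in the kernel for every real `q > 1`, FALSE at `q = 1`,
K32 = `NoGo/TopEigHeatCoerciveOne`). The tree node GAPHIGH (`TopEig.topEigGapCoercivePos_of_ge_two`): for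
every real `q ≥ 2`, `η > 0`, L-λ(q) HOLDS (existential rate) on the top-gap class `StrainGapClass η`
(`λ₂ ≤ (1 − η)λ₁`). This file types the class of fields that this puts OUT OF PLAY and shows it is exactly
the familiar witness zoo:

* POINTWISE (`card d = 3`, smooth, divergence free): `det S(x) = 0 ⇒ λ₂(x) = 0 ∧ λ₃(x) = −λ₁(x)` (over
  the tree's `BiaxialEikonal.midEig_eq_zero_of_torusStrainEig_eq_zero`); on `T³` conversely
  `λ₂(x) = 0 ⇒ det S(x) = 0`;
* the class `IsSingularStrain v :⇔ ∀ x, det S_v(x) = 0` EQUALS `{λ₂ ≡ 0}` and EQUALS the `±`-symmetric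
  core `StrainGapClass 1 v ∧ StrainGapClass 1 (−v)` of the top-gap class `λ₂ ≤ 0`; it lies in
  `StrainGapClass η` for every `η ≤ 1` and is closed under `v ↦ −v`;
* MEMBERS: every UNIDIRECTIONAL field `uniDir φ a = φ(x)·a` (`φ ∈ C¹(T³)` ARBITRARY, `a ∈ ℝ³` fixed:
  `S = ½(a ⊗ ∇φ + ∇φ ⊗ a)` has rank `≤ 2`) — all generalised shear flows `(φ(x₂,x₃), 0, 0)` and all
  `x₂`-laminates `lamU F` (`IsX2Laminate`) —; every vector laminate `A(k·x)` of the tree's class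
  `TopEigLaminate.IsLaminate` (`λ₂ ≡ 0`, tree `midEig_lamV`); every HORIZONTAL PLANAR flow (`v₃ ≡ 0`,
  `∂₃v ≡ 0`, i.e. every `x₃`-invariant 2-D flow; third strain column zero) — NOT unidirectional in general;
* EXCLUSIONS, every real `q ≥ 2`, both one-sided cores `∫(λ₁⁺)^q`, `∫((−λ₃)⁺)^q` (the second by `v ↦ −v`,
  tree `TopEigHeatCoerciveSymm`): `∃ c > 0, HeatCoerciveOn IsSingularStrain Φ_q c` (and on each member
  class); `violator_not_singular`: below that rate a zero-mean violator `heatDissipation Φ_q v < c·Φ_q v`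
  has a point with `det S ≠ 0` — it is no laminate, no unidirectional field, no planar flow;
* SCOPE IS EXACT IN THE KERNEL: at `q = 1` the smallest member class `IsX2Laminate` already refutes class
  coercivity at every rate `c > 0` (K32's zero-mean witness `lamU sinCubePrim` has dissipation `0` and
  moment `2/(3π)`); `1 < q < 2` is untouched (no GAPHIGH there; K35 covers `x₂`-laminates only for
  `q ≥ 2` too).

HONEST LIMITS. Rates are GAPHIGH's (existential: Sobolev–Poincaré / Calderón–Zygmund constants); for
`x₂`-laminates K35 (`NoGo/TopEigHeatLaminateCoercive`) has the explicit `16(q−1)/q`. L-λ(q) stays OPEN for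
every `q > 1`; no node decided, no verdict changed. [ours = assembly over the tree (GAPHIGH,
`BiaxialEikonalSpectrum(Dir)`, `TopEigHeatCoerciveSymm`, `TopEigLaminateClass`, `TopEigSimpleGap`, K32);
folklore = `3 × 3` determinants of rank-two symmetric tensors]
search for candidate a priori estimates; no regularity claim.
FILING (prove seat g28, REQUEST #54): declarations byte-identical to the no-go seat's staged `TopEigHeatSingularStrain.STAGING.lean` 86edaf3d3a0a69e9; this line is the only addition.
-/

noncomputable section

open MeasureTheory Set

namespace Summit.NavierStokesRegularity.FunctionalMining

open Literature.Analysis Literature.Analysis.FunctionSpaces Literature.Analysis.FunctionSpaces.Torus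
open TopEig TopEigLaminate LaminateDirection

namespace SingularStrain

variable {d : Type*} [Fintype d] [DecidableEq d]

/-! ## 1. Pointwise: `det S(x) = 0 ⇔ λ₂(x) = 0` -/

/-- **`det S(x) = 0 ⇒ λ₂(x) = 0 ∧ λ₃(x) = −λ₁(x)`** (`card d = 3`, smooth, divergence free): `det S = ∏ λₖ`
(`BiaxialEikonal.det_torusStrainMatrix_eq_prod`), so a sorted eigenvalue vanishes, and the tree's
`BiaxialEikonal.midEig_eq_zero_of_torusStrainEig_eq_zero` applies. [ours, over the tree] -/
theorem midEig_eq_zero_of_det_eq_zero (hd : Fintype.card d = 3)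
    {v : UnitAddTorus d → EuclideanSpace ℝ d} (hv : Torus.IsSmooth v) (hdiv : Torus.IsDivFree v)
    {x : UnitAddTorus d} (hdet : (torusStrainMatrix v x).det = 0) :
    torusStrainMidEig v x = 0 ∧ torusStrainBotEig v x = -torusStrainTopEig v x := by
  rw [BiaxialEikonal.det_torusStrainMatrix_eq_prod] at hdet
  obtain ⟨i, -, hi⟩ := Finset.prod_eq_zero_iff.mp hdet
  exact BiaxialEikonal.midEig_eq_zero_of_torusStrainEig_eq_zero hd hv hdiv hi

/-- **Conversely on `T³`: `λ₂(x) = 0 ⇒ det S(x) = 0`** (`λ₂` IS a sorted eigenvalue,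
`TopEig.torusStrainMidEig_eq_eig_one`; no divergence hypothesis). [ours, over the tree] -/
theorem det_eq_zero_of_midEig_eq_zero {v : UnitAddTorus (Fin 3) → EuclideanSpace ℝ (Fin 3)}
    {x : UnitAddTorus (Fin 3)} (h : torusStrainMidEig v x = 0) : (torusStrainMatrix v x).det = 0 := by
  rw [BiaxialEikonal.det_torusStrainMatrix_eq_prod]
  exact Finset.prod_eq_zero (Finset.mem_univ _) ((torusStrainMidEig_eq_eig_one v x).2.symm.trans h)

/-- `λ₂(−v) = −λ₂(v)` for smooth divergence-free fields (`λ₁(−v) = −λ₃(v)`, `λ₃(−v) = −λ₁(v)`, trace `0`).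
[ours, bookkeeping] -/
theorem midEig_neg {v : UnitAddTorus d → EuclideanSpace ℝ d} (hv : Torus.IsSmooth v)
    (hdiv : Torus.IsDivFree v) (x : UnitAddTorus d) :
    torusStrainMidEig (-v) x = -torusStrainMidEig v x := by
  unfold torusStrainMidEig
  rw [torusStrainTopEig_neg, torusStrainBotEig_neg, sum_torusStrainEig_eq_zero hv hdiv x,
    sum_torusStrainEig_eq_zero hv.neg ((torus_isDivFree_neg_iff v).2 hdiv) x]
  ring

/-! ## 2. The singular-strain class: `= {λ₂ ≡ 0}` = the `±`-core of the top-gap class `λ₂ ≤ 0` -/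

/-- **`IsSingularStrain v`**: the strain matrix of `v` is singular at EVERY point, `det S_v(x) = 0`.
search for candidate a priori estimates; no regularity claim. [ours] -/
def IsSingularStrain (v : UnitAddTorus d → EuclideanSpace ℝ d) : Prop :=
  ∀ x, (torusStrainMatrix v x).det = 0

/-- A singular-strain field has `λ₂ ≡ 0` (`card d = 3`, smooth, divergence free). [ours] -/
theorem IsSingularStrain.midEig_eq_zero (hd : Fintype.card d = 3) {v : UnitAddTorus d → EuclideanSpace ℝ d}
    (hv : Torus.IsSmooth v) (hdiv : Torus.IsDivFree v) (h : IsSingularStrain v) (x : UnitAddTorus d) :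
    torusStrainMidEig v x = 0 :=
  (midEig_eq_zero_of_det_eq_zero hd hv hdiv (h x)).1

/-- **On `T³`: `IsSingularStrain v ⇔ λ₂ ≡ 0`** (smooth, divergence free). [ours] -/
theorem isSingularStrain_iff_midEig {v : UnitAddTorus (Fin 3) → EuclideanSpace ℝ (Fin 3)}
    (hv : Torus.IsSmooth v) (hdiv : Torus.IsDivFree v) :
    IsSingularStrain v ↔ ∀ x, torusStrainMidEig v x = 0 :=
  ⟨fun h x => h.midEig_eq_zero (Fintype.card_fin 3) hv hdiv x,
    fun h x => det_eq_zero_of_midEig_eq_zero (h x)⟩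

/-- **A singular-strain field lies in the top-gap class `η = 1` (`λ₂ ≤ 0`).** [ours] -/
theorem IsSingularStrain.strainGapClass_one (hd : Fintype.card d = 3)
    {v : UnitAddTorus d → EuclideanSpace ℝ d} (hv : Torus.IsSmooth v) (hdiv : Torus.IsDivFree v)
    (h : IsSingularStrain v) : StrainGapClass 1 v := fun x => by
  rw [h.midEig_eq_zero hd hv hdiv x, sub_self, zero_mul]

/-- … hence in every top-gap class `η ≤ 1`. [ours] -/
theorem IsSingularStrain.strainGapClass (hd : Fintype.card d = 3) {v : UnitAddTorus d → EuclideanSpace ℝ d}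
    (hv : Torus.IsSmooth v) (hdiv : Torus.IsDivFree v) (h : IsSingularStrain v) {η : ℝ} (hη : η ≤ 1) :
    StrainGapClass η v :=
  (h.strainGapClass_one hd hv hdiv).of_le_of_divFree hd hη hv hdiv

/-- The class is closed under `v ↦ −v` (`S_{−v} = −S_v`, `det(−S) = (−1)^{card d} det S`). [ours] -/
theorem IsSingularStrain.neg {v : UnitAddTorus d → EuclideanSpace ℝ d} (h : IsSingularStrain v) :
    IsSingularStrain (-v) := fun x => by
  rw [torusStrainMatrix_neg, Matrix.det_neg, h x, mul_zero]

/-- **On `T³` the singular-strain class is EXACTLY the `±`-symmetric core of the top-gap class `λ₂ ≤ 0`: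
`IsSingularStrain v ⇔ StrainGapClass 1 v ∧ StrainGapClass 1 (−v)`** (smooth, divergence free).
[ours] -/
theorem isSingularStrain_iff_strainGapClass_one {v : UnitAddTorus (Fin 3) → EuclideanSpace ℝ (Fin 3)}
    (hv : Torus.IsSmooth v) (hdiv : Torus.IsDivFree v) :
    IsSingularStrain v ↔ StrainGapClass 1 v ∧ StrainGapClass 1 (-v) := by
  have hd : Fintype.card (Fin 3) = 3 := Fintype.card_fin 3
  have hdiv' : Torus.IsDivFree (-v) := (torus_isDivFree_neg_iff v).2 hdiv
  refine ⟨fun h => ⟨h.strainGapClass_one hd hv hdiv, h.neg.strainGapClass_one hd hv.neg hdiv'⟩,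
    fun h => (isSingularStrain_iff_midEig hv hdiv).2 fun x => ?_⟩
  obtain ⟨h1, h2⟩ := h
  rw [strainGapClass_one_iff] at h1 h2
  have h3 := h2 x
  rw [midEig_neg hv hdiv x] at h3
  exact le_antisymm (h1 x) (by linarith)

/-! ## 3. Members: unidirectional fields, the tree's laminate class, horizontal planar flows -/

/-- **The unidirectional field `uniDir φ a (x) = φ(x) · a`** (a scalar profile times a FIXED direction).
search for candidate a priori estimates; no regularity claim. [ours] -/
def uniDir (φ : UnitAddTorus d → ℝ) (a : EuclideanSpace ℝ d) : UnitAddTorus d → EuclideanSpace ℝ d :=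
  fun x => φ x • a

/-- `∂ⱼ(φ·a) = (∂ⱼφ)·a` for `φ ∈ C¹`. [ours] -/
theorem partialDeriv_uniDir {φ : UnitAddTorus d → ℝ} (hφ : Torus.IsContDiff 1 φ) (a : EuclideanSpace ℝ d)
    (j : d) (x : UnitAddTorus d) :
    Torus.partialDeriv j (uniDir φ a) x = Torus.partialDeriv j φ x • a := by
  rw [show uniDir φ a = fun y => φ y • a from rfl,
    partialDeriv_smul' hφ ((isSmooth_const _).isContDiff (by simp)),
    show Torus.partialDeriv j (fun _ : UnitAddTorus d => a) x = 0 by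
      unfold Torus.partialDeriv Torus.lineDeriv; simp,
    smul_zero, add_zero]

/-- The strain of `φ·a`: `S_{ij} = ½(∂ⱼφ·aᵢ + ∂ᵢφ·aⱼ)`, i.e. `S = ½(a ⊗ ∇φ + ∇φ ⊗ a)`. [ours] -/
theorem torusStrainMatrix_uniDir {φ : UnitAddTorus d → ℝ} (hφ : Torus.IsContDiff 1 φ)
    (a : EuclideanSpace ℝ d) (x : UnitAddTorus d) (i j : d) :
    torusStrainMatrix (uniDir φ a) x i j =
      (Torus.partialDeriv j φ x * a i + Torus.partialDeriv i φ x * a j) / 2 := by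
  simp only [torusStrainMatrix, Matrix.of_apply, partialDeriv_uniDir hφ, PiLp.smul_apply, smul_eq_mul]

/-- **A unidirectional field on `T³` has singular strain everywhere**: `det ½(a ⊗ g + g ⊗ a) = 0` for all
`a, g ∈ ℝ³` (rank `≤ 2`). [ours; folklore determinant] -/
theorem det_torusStrainMatrix_uniDir {φ : UnitAddTorus (Fin 3) → ℝ} (hφ : Torus.IsContDiff 1 φ)
    (a : EuclideanSpace ℝ (Fin 3)) (x : UnitAddTorus (Fin 3)) :
    (torusStrainMatrix (uniDir φ a) x).det = 0 := by
  rw [Matrix.det_fin_three]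
  simp only [torusStrainMatrix_uniDir hφ]
  ring

/-- `uniDir φ a` is a singular-strain field. [ours] -/
theorem isSingularStrain_uniDir {φ : UnitAddTorus (Fin 3) → ℝ} (hφ : Torus.IsContDiff 1 φ)
    (a : EuclideanSpace ℝ (Fin 3)) : IsSingularStrain (uniDir φ a) :=
  fun x => det_torusStrainMatrix_uniDir hφ a x

/-- **`IsUnidirectional v`**: `v = φ·a` for some `C¹` scalar `φ` on `T³` and some fixed `a ∈ ℝ³` (every
single-profile laminate `F(k·x)·a`, every generalised shear flow `(φ(x₂,x₃), 0, 0)`; divergence free iff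
`a·∇φ ≡ 0`). search for candidate a priori estimates; no regularity claim. [ours] -/
def IsUnidirectional (v : UnitAddTorus (Fin 3) → EuclideanSpace ℝ (Fin 3)) : Prop :=
  ∃ (φ : UnitAddTorus (Fin 3) → ℝ) (a : EuclideanSpace ℝ (Fin 3)), Torus.IsContDiff 1 φ ∧ v = uniDir φ a

/-- Unidirectional fields have singular strain everywhere. [ours] -/
theorem IsUnidirectional.isSingularStrain {v : UnitAddTorus (Fin 3) → EuclideanSpace ℝ (Fin 3)}
    (h : IsUnidirectional v) : IsSingularStrain v := by
  obtain ⟨φ, a, hφ, rfl⟩ := h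
  exact isSingularStrain_uniDir hφ a

/-- Every directional single-profile laminate `x ↦ F(k·x)·a` (any `k ∈ ℤ³`, any profile, any amplitude
vector) is unidirectional. [ours] -/
theorem isUnidirectional_dirFun_smul (k : Fin 3 → ℤ) (F : ShearProfile) (a : EuclideanSpace ℝ (Fin 3)) :
    IsUnidirectional (fun x => dirFun k F x • a) :=
  ⟨dirFun k F, a, isContDiff_dirFun k F, rfl⟩

/-- **Every `x₂`-laminate `u_F = F(x₂)·e₀` (`TopEigLaminate.lamU`) is unidirectional.** [ours] -/
theorem isUnidirectional_lamU (F : ShearProfile) : IsUnidirectional (lamU F) :=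
  isUnidirectional_dirFun_smul e2 F _

/-- The laminate class `IsX2Laminate` is unidirectional, hence singular-strain. [ours] -/
theorem isSingularStrain_of_isX2Laminate {v : UnitAddTorus (Fin 3) → EuclideanSpace ℝ (Fin 3)}
    (h : IsX2Laminate v) : IsUnidirectional v ∧ IsSingularStrain v := by
  obtain ⟨F, rfl⟩ := h
  exact ⟨isUnidirectional_lamU F, (isUnidirectional_lamU F).isSingularStrain⟩

/-- **The tree's vector-laminate class `IsLaminate` (`v = A(k·x)`, `k ≠ 0`, `k·A′ ≡ 0`) is singular-strain**
(`λ₂ ≡ 0` by `TopEigLaminate.midEig_lamV`, then §1). [ours, over the tree] -/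
theorem isSingularStrain_of_isLaminate {v : UnitAddTorus (Fin 3) → EuclideanSpace ℝ (Fin 3)}
    (h : IsLaminate v) : IsSingularStrain v := by
  obtain ⟨k, A, -, hdiv, rfl⟩ := h
  exact fun x => det_eq_zero_of_midEig_eq_zero (midEig_lamV hdiv x)

/-- **`IsHorizontalPlanar v`**: a horizontal planar flow, `v₃ ≡ 0` and `∂₃v ≡ 0` (`v = (v₁, v₂, 0)(x₁, x₂)`,
every `x₃`-invariant 2-D flow). search for candidate a priori estimates; no regularity claim. [ours] -/
def IsHorizontalPlanar (v : UnitAddTorus (Fin 3) → EuclideanSpace ℝ (Fin 3)) : Prop :=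
  (∀ x, v x 2 = 0) ∧ ∀ x, Torus.partialDeriv 2 v x = 0

/-- **A `C¹` horizontal planar flow has singular strain everywhere** (the third strain column vanishes).
[ours] -/
theorem IsHorizontalPlanar.isSingularStrain {v : UnitAddTorus (Fin 3) → EuclideanSpace ℝ (Fin 3)}
    (hv : Torus.IsContDiff 1 v) (h : IsHorizontalPlanar v) : IsSingularStrain v := fun x => by
  have hcol : ∀ i, torusStrainMatrix v x i 2 = 0 := fun i => by
    have h1 : Torus.partialDeriv i v x 2 = 0 := by
      rw [← partialDeriv_apply_coord hv i x 2, show (fun y => v y 2) = fun _ => (0 : ℝ) from funext h.1]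
      unfold Torus.partialDeriv Torus.lineDeriv; simp
    simp only [torusStrainMatrix, Matrix.of_apply, h.2 x, PiLp.zero_apply, h1, add_zero, zero_div]
  exact Matrix.det_eq_zero_of_column_eq_zero 2 hcol

/-! ## 4. Exclusions for every real `q ≥ 2` (over the tree node GAPHIGH) -/

variable {q : ℝ}

/-- **For every real `q ≥ 2` the singular-strain class is heat-coercive, both one-sided cores**:
`∃ c > 0, HeatCoerciveOn IsSingularStrain (∫(λ₁⁺)^q) c ∧ HeatCoerciveOn IsSingularStrain (∫((−λ₃)⁺)^q) c` — the
tree node `TopEig.topEigGapCoercivePos_of_ge_two` at `η = 1` and §2; the second core by `v ↦ −v`. The rate is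
GAPHIGH's (existential). [ours, assembly over the tree] -/
theorem heatCoercivePos_singular (hq : 2 ≤ q) :
    ∃ c : ℝ, 0 < c ∧ HeatCoerciveOn (d := Fin 3) IsSingularStrain (torusTopEigMoment q) c ∧
      HeatCoerciveOn (d := Fin 3) IsSingularStrain (torusNegBotEigMoment q) c := by
  obtain ⟨c, hc, h⟩ := topEigGapCoercivePos_of_ge_two (η := 1) hq one_pos
  have h' : HeatCoerciveOn (d := Fin 3) (StrainGapClass 1) (torusTopEigMoment q) c := h
  refine ⟨c, hc, fun hd v hv hdiv hmean hs => h' hd v hv hdiv hmean (hs.strainGapClass_one hd hv hdiv),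
    fun hd v hv hdiv hmean hs => ?_⟩
  have hdiv' : Torus.IsDivFree (-v) := (torus_isDivFree_neg_iff v).2 hdiv
  have h2 := h' hd (-v) hv.neg hdiv' ((torus_hasZeroMean_neg_iff v).2 hmean)
    (hs.neg.strainGapClass_one hd hv.neg hdiv')
  rw [torusTopEigMoment_neg, heatDissipation_neg, ← torusNegBotEigMoment_eq_comp_neg] at h2
  exact h2

/-- **No unidirectional field refutes L-λ(q), `q ≥ 2`**: `∃ c > 0, HeatCoerciveOn IsUnidirectional Φ_q c`, both
cores. [ours] -/
theorem heatCoercivePos_unidirectional (hq : 2 ≤ q) :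
    ∃ c : ℝ, 0 < c ∧ HeatCoerciveOn (d := Fin 3) IsUnidirectional (torusTopEigMoment q) c ∧
      HeatCoerciveOn (d := Fin 3) IsUnidirectional (torusNegBotEigMoment q) c := by
  obtain ⟨c, hc, h1, h2⟩ := heatCoercivePos_singular hq
  exact ⟨c, hc, h1.of_imp fun _ v _ _ _ hu => hu.isSingularStrain,
    h2.of_imp fun _ v _ _ _ hu => hu.isSingularStrain⟩

/-- **No vector laminate of the tree's class `IsLaminate` refutes L-λ(q), `q ≥ 2`** (both cores; at `q = 2`
the tree has the explicit rate `8π²`, `heatCoerciveOn_isLaminate_two`). [ours] -/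
theorem heatCoercivePos_laminate (hq : 2 ≤ q) :
    ∃ c : ℝ, 0 < c ∧ HeatCoerciveOn (d := Fin 3) IsLaminate (torusTopEigMoment q) c ∧
      HeatCoerciveOn (d := Fin 3) IsLaminate (torusNegBotEigMoment q) c := by
  obtain ⟨c, hc, h1, h2⟩ := heatCoercivePos_singular hq
  exact ⟨c, hc, h1.of_imp fun _ v _ _ _ hl => isSingularStrain_of_isLaminate hl,
    h2.of_imp fun _ v _ _ _ hl => isSingularStrain_of_isLaminate hl⟩

/-- **No `x₂`-laminate refutes L-λ(q), `q ≥ 2`** (existential rate here; K35 has the explicit `16(q−1)/q`).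
[ours] -/
theorem heatCoercivePos_x2Laminate (hq : 2 ≤ q) :
    ∃ c : ℝ, 0 < c ∧ HeatCoerciveOn (d := Fin 3) IsX2Laminate (torusTopEigMoment q) c ∧
      HeatCoerciveOn (d := Fin 3) IsX2Laminate (torusNegBotEigMoment q) c := by
  obtain ⟨c, hc, h1, h2⟩ := heatCoercivePos_singular hq
  exact ⟨c, hc, h1.of_imp fun _ v _ _ _ hl => (isSingularStrain_of_isX2Laminate hl).2,
    h2.of_imp fun _ v _ _ _ hl => (isSingularStrain_of_isX2Laminate hl).2⟩

/-- **No horizontal planar (`x₃`-invariant 2-D) flow refutes L-λ(q), `q ≥ 2`** (both cores). [ours] -/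
theorem heatCoercivePos_horizontalPlanar (hq : 2 ≤ q) :
    ∃ c : ℝ, 0 < c ∧ HeatCoerciveOn (d := Fin 3) IsHorizontalPlanar (torusTopEigMoment q) c ∧
      HeatCoerciveOn (d := Fin 3) IsHorizontalPlanar (torusNegBotEigMoment q) c := by
  obtain ⟨c, hc, h1, h2⟩ := heatCoercivePos_singular hq
  exact ⟨c, hc, h1.of_imp fun _ v hv _ _ hp => hp.isSingularStrain (hv.isContDiff (by simp)),
    h2.of_imp fun _ v hv _ _ hp => hp.isSingularStrain (hv.isContDiff (by simp))⟩

/-- **A violator has a point of NON-singular strain**: for `q ≥ 2` there is `c₀ > 0` (GAPHIGH's rate at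
`η = 1`) such that every smooth divergence-free zero-mean `v` with `heatDissipation Φ_q v < c·Φ_q v`, `c ≤ c₀`,
has a point `x` with `det S_v(x) ≠ 0` (all three strain eigenvalues non-zero, `λ₂(x) ≠ 0`). [ours] -/
theorem violator_not_singular (hq : 2 ≤ q) :
    ∃ c₀ : ℝ, 0 < c₀ ∧ ∀ c : ℝ, c ≤ c₀ → ∀ v : UnitAddTorus (Fin 3) → EuclideanSpace ℝ (Fin 3),
      Torus.IsSmooth v → Torus.IsDivFree v → Torus.HasZeroMean v →
      heatDissipation (torusTopEigMoment q) v < c * torusTopEigMoment q v →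
        ∃ x, (torusStrainMatrix v x).det ≠ 0 := by
  obtain ⟨c₀, hc₀, htop, -⟩ := heatCoercivePos_singular hq
  refine ⟨c₀, hc₀, fun c hc v hv hdiv hmean hlt => ?_⟩
  by_contra hall
  have hs : IsSingularStrain v := fun x => not_not.mp fun hx => hall ⟨x, hx⟩
  have h1 := htop (Fintype.card_fin 3) v hv hdiv hmean hs
  have h2 : c * torusTopEigMoment q v ≤ c₀ * torusTopEigMoment q v :=
    mul_le_mul_of_nonneg_right hc (torusTopEigMoment_nonneg q v)
  linarith

/-- The same for the `−λ₃` core. [ours] -/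
theorem violator_not_singular_negBot (hq : 2 ≤ q) :
    ∃ c₀ : ℝ, 0 < c₀ ∧ ∀ c : ℝ, c ≤ c₀ → ∀ v : UnitAddTorus (Fin 3) → EuclideanSpace ℝ (Fin 3),
      Torus.IsSmooth v → Torus.IsDivFree v → Torus.HasZeroMean v →
      heatDissipation (torusNegBotEigMoment q) v < c * torusNegBotEigMoment q v →
        ∃ x, (torusStrainMatrix v x).det ≠ 0 := by
  obtain ⟨c₀, hc₀, -, hbot⟩ := heatCoercivePos_singular hq
  refine ⟨c₀, hc₀, fun c hc v hv hdiv hmean hlt => ?_⟩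
  by_contra hall
  have hs : IsSingularStrain v := fun x => not_not.mp fun hx => hall ⟨x, hx⟩
  have h1 := hbot (Fintype.card_fin 3) v hv hdiv hmean hs
  have h2 : c * torusNegBotEigMoment q v ≤ c₀ * torusNegBotEigMoment q v :=
    mul_le_mul_of_nonneg_right hc (torusNegBotEigMoment_nonneg q v)
  linarith

/-- **COROLLARY — the typed witness exclusions for (F2) at real `q ≥ 2`.** Below GAPHIGH's rate a zero-mean
violator of L-λ(q) is NOT unidirectional, NOT a vector laminate (`IsLaminate`), NOT an `x₂`-laminate and NOT
a horizontal planar flow. [ours] -/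
theorem violator_exclusions (hq : 2 ≤ q) :
    ∃ c₀ : ℝ, 0 < c₀ ∧ ∀ c : ℝ, c ≤ c₀ → ∀ v : UnitAddTorus (Fin 3) → EuclideanSpace ℝ (Fin 3),
      Torus.IsSmooth v → Torus.IsDivFree v → Torus.HasZeroMean v →
      heatDissipation (torusTopEigMoment q) v < c * torusTopEigMoment q v →
        ¬ IsUnidirectional v ∧ ¬ IsLaminate v ∧ ¬ IsX2Laminate v ∧ ¬ IsHorizontalPlanar v := by
  obtain ⟨c₀, hc₀, h⟩ := violator_not_singular hq
  refine ⟨c₀, hc₀, fun c hc v hv hdiv hmean hlt => ?_⟩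
  obtain ⟨x, hx⟩ := h c hc v hv hdiv hmean hlt
  exact ⟨fun hu => hx (hu.isSingularStrain x), fun hl => hx (isSingularStrain_of_isLaminate hl x),
    fun hl => hx ((isSingularStrain_of_isX2Laminate hl).2 x),
    fun hp => hx (hp.isSingularStrain (hv.isContDiff (by simp)) x)⟩

/-! ## 5. The scope is exact in the kernel: at `q = 1` the smallest member class already kills -/

/-- **At `q = 1` class coercivity FAILS at every rate `c > 0` already on `x₂`-laminates** (both cores): K32's
zero-mean witness `lamU sinCubePrim` has `heatDissipation Φ₁ = 0` and `Φ₁ = 2/(3π) > 0`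
(`TopEigLaminate.heatDissipation_topEigMoment_one_sinCubePrim`, `topEigMoment_one_sinCubePrim`). [ours, over K32] -/
theorem not_heatCoerciveOn_x2Laminate_one {c : ℝ} (hc : 0 < c) :
    ¬ HeatCoerciveOn (d := Fin 3) IsX2Laminate (torusTopEigMoment 1) c ∧
      ¬ HeatCoerciveOn (d := Fin 3) IsX2Laminate (torusNegBotEigMoment 1) c := by
  obtain ⟨hm, hm'⟩ := topEigMoment_one_sinCubePrim
  obtain ⟨hδ, hδ'⟩ := heatDissipation_topEigMoment_one_sinCubePrim
  have hπ : 0 < 2 / (3 * Real.pi) := by positivity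
  refine ⟨fun h => ?_, fun h => ?_⟩
  · have h1 := h (Fintype.card_fin 3) (lamU sinCubePrim) (isSmooth_lamU _) (isDivFree_lamU _)
      hasZeroMean_lamU_sinCubePrim ⟨sinCubePrim, rfl⟩
    rw [hm, hδ] at h1
    nlinarith
  · have h1 := h (Fintype.card_fin 3) (lamU sinCubePrim) (isSmooth_lamU _) (isDivFree_lamU _)
      hasZeroMean_lamU_sinCubePrim ⟨sinCubePrim, rfl⟩
    rw [hm', hδ'] at h1
    nlinarith

/-- **Hence at `q = 1` no rate `c > 0` is coercive on the unidirectional class or on the singular-strain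
class either** (larger classes, `HeatCoerciveOn.of_imp`): the `q ≥ 2` exclusions of §4 do not extend to
`q = 1`; the range `1 < q < 2` is not touched by this file. [ours] -/
theorem not_heatCoerciveOn_singular_one {c : ℝ} (hc : 0 < c) :
    ¬ HeatCoerciveOn (d := Fin 3) IsUnidirectional (torusTopEigMoment 1) c ∧
      ¬ HeatCoerciveOn (d := Fin 3) IsSingularStrain (torusTopEigMoment 1) c ∧
      ¬ HeatCoerciveOn (d := Fin 3) IsSingularStrain (torusNegBotEigMoment 1) c := by
  obtain ⟨h1, h2⟩ := not_heatCoerciveOn_x2Laminate_one hc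
  exact ⟨fun h => h1 (h.of_imp fun _ v _ _ _ hl => (isSingularStrain_of_isX2Laminate hl).1),
    fun h => h1 (h.of_imp fun _ v _ _ _ hl => (isSingularStrain_of_isX2Laminate hl).2),
    fun h => h2 (h.of_imp fun _ v _ _ _ hl => (isSingularStrain_of_isX2Laminate hl).2)⟩

end SingularStrain

end Summit.NavierStokesRegularity.FunctionalMining

end
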